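import Mathlib.Combinatorics.Hall.Basic
import Mathlib.Combinatorics.Enumerative.DoubleCounting
import Mathlib.Data.Finset.Sups
import Mathlib.Order.UpperLower.Basic
import Summits.CriticalPhenomena.PercolationContinuityZ3.Theorems.PercNearOneGluingNoHeavyLowerTailAntiBandMatching

/-!
# `NoHeavyLowerTail` (crux stmt-CriticalPhenomena-4575), lane prim-ineq-gen-4 (gen 33): the anti-band inequality for a THRESHOLD JUNTA, in every cell

Support file (`--supports stmt-CriticalPhenomena-4575`; memo `run/shared/lean/prim/prim-ineq-gen-4/FINDING-THRESHOLD-JUNTA-g33.md` §1).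
Pure finite combinatorics, no definitions, no `sorry`, standard axioms.  (AB_l)(n): for up-sets `A, B` of `Finset (Fin n)` and
`O = {s | #s < l ∨ #sᶜ < l}`, `#{s ∈ A ∩ Bᶜˢ | O s} ≤ #{s ∈ A ∩ B | O s}` (conjectured for all `2l ≤ n`).  Gen 21: it holds for `A` and EVERY
up-set `B` once the outer part of `A` admits a *covering map* (`AntiBandMatching.antiBand_of_covering_map`); gen 32: principal filters.
HERE: **for every `n ≥ 2l`, every `T₀ : Finset (Fin n)` and every `k` with `#T₀ < 2k`, (AB_l)(n) holds for `(Th, B)` and for `(B, Th)` for all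
up-sets `B`, where `Th = {s | k ≤ #(s ∩ T₀)}`** ("at least `k` of the coordinates `T₀`"; `#T₀ = k`: the principal filter `↑T₀`; `#T₀ = 2k − 1`:
the majority function of `T₀` — the first self-dual families beyond the dictator settled in every cell).  [`#T₀ ≥ 2k` reduces to these; not here.]
THE COVERING MAP (`s = R ∪ S`, `R = s ∩ T₀`, `S = s \ T₀`, `t = #T₀`, `Z = T₀ᶜ`, `m = #Z`, `r = l − 1`): small `s` (`a = #R ≥ k > t/2`):
`Φ s = (σ R ∪ S)ᶜ`, `σ` an injection of `a`-subsets of `T₀` into `(t−a)`-subsets inside them (`exists_shrink_injection`); huge `s`, `u = sᶜ = R' ∪ S'`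
(`a' = #R' ≤ t−k`, `b' = #S'`, `a'+b' ≤ r`): if `b' ≤ r − t + a'` then `Φ s = τ R' ∪ S'` (small; `τ` injects `a'`-subsets into `(t−a')`-supersets,
`exists_grow_injection`), else `Φ s = (ρ R' ∪ λ S')ᶜ` with `ρ` a Kneser derangement of the `a'`-subsets of `T₀` (`2a' ≤ t`) and `λ S' = Z \ S'`
when `a' + m − b' ≤ r`, else a Kneser derangement of the `b'`-subsets of `Z` (then `2b' < m`) — all four injections from the Hall lemma `exists_injOn_of_degree_le` (the Kneser ones as in gen 32's
`AntiBandPrincipal.exists_kneser_derangement`, re-derived inside the proof: that module has no olean on the farm yet, so it is not imported).  Cardinalities of the `T₀`- and `Z`-parts separate the regimes, so `Φ` is injective.  Validated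
numerically for all `(n ≤ 12, l, #T₀, k)` (876 cells, `work/py/thresh_check.py`) before formalisation.
-/

namespace Summit.CriticalPhenomena.PercolationContinuityZ3.Theorems.AntiBandThreshold

open Finset
open scoped FinsetFamily

/-- **Injection along a relation with left degrees `≥ d > 0` and right degrees `≤ d`** (Hall's condition by double counting). [folklore] -/
theorem exists_injOn_of_degree_le {α : Type*} [DecidableEq α] (X Y : Finset α) (rel : α → α → Prop) [DecidableRel rel]
    (d : ℕ) (hd : 0 < d) (hX : ∀ x ∈ X, d ≤ #(Y.filter fun y => rel x y)) (hY : ∀ y ∈ Y, #(X.filter fun x => rel x y) ≤ d) :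
    ∃ f : α → α, Set.InjOn f X ∧ ∀ x ∈ X, f x ∈ Y ∧ rel x (f x) := by
  classical
  let t : X → Finset α := fun x => Y.filter fun y => rel x.1 y
  have hHall : ∀ S : Finset X, #S ≤ #(S.biUnion t) := by
    intro S
    set S' : Finset α := S.map (Function.Embedding.subtype _) with hS'
    have hS'X : S' ⊆ X := fun u hu => by obtain ⟨a, -, rfl⟩ := mem_map.1 hu; exact a.2
    have key : #S' * d ≤ #(S.biUnion t) * d := by
      refine card_mul_le_card_mul (fun x y => rel x y) (fun x hx => ?_) (fun y hy => ?_)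
      · obtain ⟨a, ha, hax⟩ := mem_map.1 hx
        refine (hX x (hS'X hx)).trans (card_le_card fun y hy => ?_)
        rw [mem_filter] at hy
        rw [mem_bipartiteAbove]
        refine ⟨mem_biUnion.2 ⟨a, ha, ?_⟩, hy.2⟩
        show y ∈ Y.filter fun y => rel a.1 y
        rw [show (a : α) = x from hax, mem_filter]; exact hy
      · have hyY : y ∈ Y := by obtain ⟨a, -, hay⟩ := mem_biUnion.1 hy; exact (mem_filter.1 hay).1
        refine (card_le_card fun x hx => ?_).trans (hY y hyY)
        rw [mem_bipartiteBelow] at hx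
        exact mem_filter.2 ⟨hS'X hx.1, hx.2⟩
    rw [← card_map (Function.Embedding.subtype _)]
    exact Nat.le_of_mul_le_mul_right key hd
  obtain ⟨f, hfinj, hft⟩ := (all_card_le_biUnion_card_iff_exists_injective t).1 hHall
  refine ⟨fun x => if h : x ∈ X then f ⟨x, h⟩ else x, fun x hx x' hx' h => ?_, fun x hx => ?_⟩
  · have hxX : x ∈ X := hx
    have hx'X : x' ∈ X := hx'
    simp only [dif_pos hxX, dif_pos hx'X] at h
    exact congrArg Subtype.val (hfinj h)
  · simp only [dif_pos hx]
    exact ⟨(mem_filter.1 (hft ⟨x, hx⟩)).1, (mem_filter.1 (hft ⟨x, hx⟩)).2⟩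

/-- The `c`-subsets of `T₀` contained in a given `a`-subset `R ⊆ T₀` are `C(a, c)` many. [folklore] -/
theorem card_powersetCard_filter_subset {α : Type*} [DecidableEq α] (T₀ R : Finset α) (a c : ℕ) (hR : R ∈ T₀.powersetCard a) :
    #((T₀.powersetCard c).filter fun R' => R' ⊆ R) = a.choose c := by
  rw [mem_powersetCard] at hR
  have : (T₀.powersetCard c).filter (fun R' => R' ⊆ R) = R.powersetCard c := by
    ext R'
    rw [mem_filter, mem_powersetCard, mem_powersetCard]
    exact ⟨fun h => ⟨h.2, h.1.2⟩, fun h => ⟨⟨h.1.trans hR.1, h.2⟩, h.1⟩⟩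
  rw [this, card_powersetCard, hR.2]

/-- The `a`-subsets of `T₀` containing a given `c`-subset `R' ⊆ T₀` are `C(#T₀ − c, a − c)` many (`c ≤ a`). [folklore] -/
theorem card_powersetCard_filter_superset {α : Type*} [DecidableEq α] (T₀ R' : Finset α) (a c : ℕ) (hca : c ≤ a)
    (hR' : R' ∈ T₀.powersetCard c) : #((T₀.powersetCard a).filter fun R => R' ⊆ R) = (#T₀ - c).choose (a - c) := by
  rw [mem_powersetCard] at hR'
  rw [← hR'.2, ← card_sdiff_of_subset hR'.1, ← card_powersetCard (a - #R') (T₀ \ R')]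
  refine card_bij (fun R _ => R \ R') (fun R hR => ?_) (fun R₁ hR₁ R₂ hR₂ h => ?_) (fun Q hQ => ?_)
  · rw [mem_filter, mem_powersetCard] at hR
    rw [mem_powersetCard, card_sdiff_of_subset hR.2, hR.1.2]
    exact ⟨sdiff_subset_sdiff hR.1.1 le_rfl, rfl⟩
  · rw [mem_filter] at hR₁ hR₂
    have h' : R₁ \ R' ∪ R' = R₂ \ R' ∪ R' := by rw [h]
    rwa [sdiff_union_of_subset hR₁.2, sdiff_union_of_subset hR₂.2] at h'
  · rw [mem_powersetCard] at hQ
    have hQdisj : Disjoint Q R' := Finset.disjoint_left.2 fun x hx hx' => (mem_sdiff.1 (hQ.1 hx)).2 hx'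
    refine ⟨Q ∪ R', ?_, union_sdiff_cancel_right hQdisj⟩
    rw [mem_filter, mem_powersetCard, card_union_of_disjoint hQdisj, hQ.2]
    exact ⟨⟨union_subset (fun x hx => (mem_sdiff.1 (hQ.1 hx)).1) hR'.1, by omega⟩, subset_union_right⟩

/-- **Shrinking injection**: `a`-subsets of `T₀` into `c`-subsets inside them, when `C(#T₀ − c, a − c) ≤ C(a, c)` (`0 < C(a,c)`). [folklore] -/
theorem exists_shrink_injection {α : Type*} [DecidableEq α] (T₀ : Finset α) (a c : ℕ) (hca : c ≤ a)
    (hbin : (#T₀ - c).choose (a - c) ≤ a.choose c) : ∃ σ : Finset α → Finset α, Set.InjOn σ (T₀.powersetCard a) ∧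
      ∀ R ∈ T₀.powersetCard a, σ R ∈ T₀.powersetCard c ∧ σ R ⊆ R := by
  classical
  exact exists_injOn_of_degree_le (T₀.powersetCard a) (T₀.powersetCard c) (fun R R' => R' ⊆ R) (a.choose c)
    (Nat.choose_pos hca) (fun R hR => (card_powersetCard_filter_subset T₀ R a c hR).symm.le)
    (fun R' hR' => (card_powersetCard_filter_superset T₀ R' a c hca hR').trans_le hbin)

/-- **Growing injection**: `c`-subsets of `T₀` into `a`-supersets inside `T₀`, when `C(a, c) ≤ C(#T₀ − c, a − c)`, `c ≤ a ≤ #T₀`. [folklore] -/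
theorem exists_grow_injection {α : Type*} [DecidableEq α] (T₀ : Finset α) (a c : ℕ) (hca : c ≤ a) (hat : a ≤ #T₀)
    (hbin : a.choose c ≤ (#T₀ - c).choose (a - c)) : ∃ τ : Finset α → Finset α, Set.InjOn τ (T₀.powersetCard c) ∧
      ∀ R' ∈ T₀.powersetCard c, τ R' ∈ T₀.powersetCard a ∧ R' ⊆ τ R' := by
  classical
  exact exists_injOn_of_degree_le (T₀.powersetCard c) (T₀.powersetCard a) (fun R' R => R' ⊆ R) ((#T₀ - c).choose (a - c))
    (Nat.choose_pos (by omega)) (fun R' hR' => (card_powersetCard_filter_superset T₀ R' a c hca hR').symm.le)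
    (fun R hR => (card_powersetCard_filter_subset T₀ R a c hR).trans_le hbin)

/-- **(AB_l)(n) for a threshold junta on the left.**  For `1 ≤ l`, `2l ≤ n`, any `T₀ : Finset (Fin n)`, any `k` with `#T₀ < 2k`, and any up-set `V`:
`#{s ∈ Th ∩ Vᶜˢ | #s < l ∨ #sᶜ < l} ≤ #{s ∈ Th ∩ V | #s < l ∨ #sᶜ < l}` where `Th = {s | k ≤ #(s ∩ T₀)}` (`#T₀ = k`: principal filter `↑T₀`;
`#T₀ = 2k − 1`: majority of `T₀`) — the covering map of the module docstring fed to `AntiBandMatching.antiBand_of_covering_map`. [this work] -/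
theorem antiBand_threshold_left {n : ℕ} (l : ℕ) (hl : 1 ≤ l) (h2l : 2 * l ≤ n) (T₀ : Finset (Fin n)) (k : ℕ)
    (hkt : #T₀ < 2 * k) (V : Finset (Finset (Fin n))) (hV : IsUpperSet (V : Set (Finset (Fin n)))) :
    #(((univ.filter fun s : Finset (Fin n) => k ≤ #(s ∩ T₀)) ∩ Vᶜˢ).filter fun s => #s < l ∨ #sᶜ < l)
      ≤ #(((univ.filter fun s : Finset (Fin n) => k ≤ #(s ∩ T₀)) ∩ V).filter fun s => #s < l ∨ #sᶜ < l) := by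
  classical
  set W : Finset (Finset (Fin n)) := univ.filter fun s => k ≤ #(s ∩ T₀) with hWdef
  set t : ℕ := #T₀ with htdef
  set Z : Finset (Fin n) := T₀ᶜ with hZdef
  set r : ℕ := l - 1 with hrdef
  have hZcard : #Z = n - t := by rw [hZdef, card_compl, Fintype.card_fin]
  have htn : t ≤ n := by have := card_le_univ T₀; rwa [Fintype.card_fin] at this
  have hcardc : ∀ s : Finset (Fin n), #sᶜ = n - #s := fun s => by rw [card_compl, Fintype.card_fin]
  have hlen : ∀ s : Finset (Fin n), #s ≤ n := fun s => by have := card_le_univ s; rwa [Fintype.card_fin] at this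
  have hmemW' : ∀ s : Finset (Fin n), s ∈ W.filter (fun s => #s < l ∨ #sᶜ < l) ↔ k ≤ #(s ∩ T₀) ∧ (#s < l ∨ #sᶜ < l) := by
    intro s; rw [mem_filter, hWdef, mem_filter]; simp only [mem_univ, true_and]
  -- elementary set algebra relative to the splitting `univ = T₀ ⊔ Z`
  have hsdZ : ∀ u : Finset (Fin n), u \ T₀ ⊆ Z := fun u x hx => by rw [hZdef, mem_compl]; exact (mem_sdiff.1 hx).2
  have hZint : ∀ u : Finset (Fin n), u \ T₀ = Z \ (Z \ u) := fun u => by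
    rw [sdiff_sdiff_right_self]; ext x; rw [mem_sdiff, inf_eq_inter, mem_inter, hZdef, mem_compl]; tauto
  have hparts : ∀ X Y : Finset (Fin n), X ⊆ T₀ → Y ⊆ Z → (X ∪ Y) ∩ T₀ = X ∧ (X ∪ Y) \ T₀ = Y ∧ #(X ∪ Y) = #X + #Y := by
    intro X Y hX hY
    have hYT : ∀ y ∈ Y, y ∉ T₀ := fun y hy => by have := hY hy; rw [hZdef, mem_compl] at this; exact this
    refine ⟨?_, ?_, card_union_of_disjoint (disjoint_left.2 fun x hxX hxY => hYT x hxY (hX hxX))⟩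
    · ext x; rw [mem_inter, mem_union]
      exact ⟨fun h => h.1.elim id fun h' => absurd h.2 (hYT x h'), fun h => ⟨Or.inl h, hX h⟩⟩
    · ext x; rw [mem_sdiff, mem_union]
      exact ⟨fun h => h.1.elim (fun h' => absurd (hX h') h.2) id, fun h => ⟨Or.inr h, hYT x h⟩⟩
  have hrec : ∀ u : Finset (Fin n), (u ∩ T₀) ∪ (u \ T₀) = u := fun u => by
    ext x; rw [mem_union, mem_inter, mem_sdiff]; tauto
  have hcardu : ∀ u : Finset (Fin n), #(u ∩ T₀) + #(u \ T₀) = #u := fun u => card_inter_add_card_sdiff u T₀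
  have hT₀sd : ∀ u : Finset (Fin n), #(T₀ \ u) + #(u ∩ T₀) = t := fun u => by
    rw [inter_comm]; exact card_sdiff_add_card_inter T₀ u
  have hZsd : ∀ u : Finset (Fin n), #(Z \ u) + #(u \ T₀) = #Z := fun u => by
    rw [hZint u, sdiff_sdiff_right_self]; exact card_sdiff_add_card_inter Z u
  have hsT : ∀ s : Finset (Fin n), s ∩ T₀ = T₀ \ sᶜ := fun s => by ext x; rw [mem_inter, mem_sdiff, mem_compl]; tauto
  have hpc : ∀ u : Finset (Fin n), u ∩ T₀ ∈ T₀.powersetCard #(u ∩ T₀) := fun u => mem_powersetCard.2 ⟨inter_subset_right, rfl⟩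
  have hpcZ : ∀ u : Finset (Fin n), u \ T₀ ∈ Z.powersetCard #(u \ T₀) := fun u => mem_powersetCard.2 ⟨hsdZ u, rfl⟩
  -- the four auxiliary injections (trivial maps outside the admissible levels); `kn T₀ ·` / `kn Z ·` are the Kneser derangements `ρ` / `κ`
  have hσ : ∀ a : ℕ, ∃ σ : Finset (Fin n) → Finset (Fin n), (t - a ≤ a ∧ a ≤ t) →
      (Set.InjOn σ (T₀.powersetCard a) ∧ ∀ R ∈ T₀.powersetCard a, σ R ∈ T₀.powersetCard (t - a) ∧ σ R ⊆ R) := by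
    intro a
    by_cases h : t - a ≤ a ∧ a ≤ t
    · have hbin : (t - (t - a)).choose (a - (t - a)) ≤ a.choose (t - a) :=
        le_of_eq (by rw [show t - (t - a) = a by omega, Nat.choose_symm h.1])
      obtain ⟨σ, h1, h2⟩ := exists_shrink_injection T₀ a (t - a) h.1 hbin
      exact ⟨σ, fun _ => ⟨h1, h2⟩⟩
    · exact ⟨id, fun h' => absurd h' h⟩
  choose σ hσ using hσ
  have hτ : ∀ c : ℕ, ∃ τ : Finset (Fin n) → Finset (Fin n), 2 * c ≤ t →
      (Set.InjOn τ (T₀.powersetCard c) ∧ ∀ R' ∈ T₀.powersetCard c, τ R' ∈ T₀.powersetCard (t - c) ∧ R' ⊆ τ R') := by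
    intro c
    by_cases h : 2 * c ≤ t
    · have hbin : (t - c).choose c ≤ (t - c).choose (t - c - c) := le_of_eq (by rw [Nat.choose_symm (show c ≤ t - c by omega)])
      obtain ⟨τ, h1, h2⟩ := exists_grow_injection T₀ (t - c) c (by omega) (by omega) hbin
      exact ⟨τ, fun _ => ⟨h1, h2⟩⟩
    · exact ⟨id, fun h' => absurd h' h⟩
  choose τ hτ using hτ
  have hkn : ∀ (Y : Finset (Fin n)) (c : ℕ), ∃ ρ : Finset (Fin n) → Finset (Fin n), 2 * c ≤ #Y →
      (Set.InjOn ρ (Y.powersetCard c) ∧ ∀ R' ∈ Y.powersetCard c, ρ R' ∈ Y.powersetCard c ∧ Disjoint R' (ρ R')) := by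
    intro Y c
    by_cases h : 2 * c ≤ #Y
    · -- Kneser derangement (as gen 32's `AntiBandPrincipal.exists_kneser_derangement`): disjointness on `Y.powersetCard c` is regular
      have hcount : ∀ v ∈ Y.powersetCard c, #((Y.powersetCard c).filter fun u => Disjoint u v) = (#Y - c).choose c := by
        intro v hv
        rw [mem_powersetCard] at hv
        have : (Y.powersetCard c).filter (fun u => Disjoint u v) = (Y \ v).powersetCard c := by
          ext u
          rw [mem_filter, mem_powersetCard, mem_powersetCard]
          constructor
          · rintro ⟨⟨huY, huc⟩, huv⟩
            exact ⟨fun a ha => mem_sdiff.2 ⟨huY ha, fun hav => disjoint_left.1 huv ha hav⟩, huc⟩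
          · rintro ⟨huYv, huc⟩
            exact ⟨⟨fun a ha => (mem_sdiff.1 (huYv ha)).1, huc⟩, disjoint_left.2 fun a ha hav => (mem_sdiff.1 (huYv ha)).2 hav⟩
        rw [this, card_powersetCard, card_sdiff_of_subset hv.1, hv.2]
      have hcount' : ∀ u ∈ Y.powersetCard c, #((Y.powersetCard c).filter fun v => Disjoint u v) = (#Y - c).choose c := by
        intro u hu
        have : (Y.powersetCard c).filter (fun v => Disjoint u v) = (Y.powersetCard c).filter (fun v => Disjoint v u) := by
          ext v; rw [mem_filter, mem_filter, disjoint_comm]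
        rw [this, hcount u hu]
      obtain ⟨ρ, h1, h2⟩ := exists_injOn_of_degree_le (Y.powersetCard c) (Y.powersetCard c) (fun u v => Disjoint u v)
        ((#Y - c).choose c) (Nat.choose_pos (by omega)) (fun u hu => (hcount' u hu).symm.le) (fun v hv => (hcount v hv).le)
      exact ⟨ρ, fun _ => ⟨h1, h2⟩⟩
    · exact ⟨id, fun h' => absurd h' h⟩
  choose kn hkn using hkn
  -- the covering map (`lam`, `Ψ` act on the complement `u = sᶜ` of a huge member `s`)
  let lam : Finset (Fin n) → Finset (Fin n) := fun u =>
    if #(u ∩ T₀) + #Z ≤ r + #(u \ T₀) then Z \ u else kn Z (#(u \ T₀)) (u \ T₀)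
  let Ψ : Finset (Fin n) → Finset (Fin n) := fun u =>
    if #(u \ T₀) + t ≤ r + #(u ∩ T₀) then τ (#(u ∩ T₀)) (u ∩ T₀) ∪ (u \ T₀) else (kn T₀ (#(u ∩ T₀)) (u ∩ T₀) ∪ lam u)ᶜ
  let Φ : Finset (Fin n) → Finset (Fin n) := fun s => if #s < l then (σ (#(s ∩ T₀)) (s ∩ T₀) ∪ (s \ T₀))ᶜ else Ψ sᶜ
  -- regime A: small members (image huge)
  have hA : ∀ s : Finset (Fin n), s ∈ W.filter (fun s => #s < l ∨ #sᶜ < l) → #s < l →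
      (Φ s)ᶜ ∩ T₀ = σ (#(s ∩ T₀)) (s ∩ T₀) ∧ (Φ s)ᶜ \ T₀ = s \ T₀ ∧ #((Φ s)ᶜ ∩ T₀) + #(s ∩ T₀) = t ∧
      σ (#(s ∩ T₀)) (s ∩ T₀) ⊆ s ∩ T₀ ∧ (t - #(s ∩ T₀) ≤ #(s ∩ T₀) ∧ #(s ∩ T₀) ≤ t) ∧
      Φ s ∈ W.filter (fun s => #s < l ∨ #sᶜ < l) ∧ ¬ #(Φ s) < l := by
    intro s hs hsl
    obtain ⟨hk, -⟩ := (hmemW' s).1 hs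
    have hat : #(s ∩ T₀) ≤ t := card_le_card inter_subset_right
    have hlev : t - #(s ∩ T₀) ≤ #(s ∩ T₀) ∧ #(s ∩ T₀) ≤ t := ⟨by omega, hat⟩
    obtain ⟨hmem, hsubR⟩ := (hσ (#(s ∩ T₀)) hlev).2 (s ∩ T₀) (hpc s)
    rw [mem_powersetCard] at hmem
    have hΦ : Φ s = (σ (#(s ∩ T₀)) (s ∩ T₀) ∪ (s \ T₀))ᶜ := by simp only [Φ, if_pos hsl]
    obtain ⟨h1, h2, h3⟩ := hparts _ _ hmem.1 (hsdZ s)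
    have hsz := hcardu s; have hc := hcardc (σ (#(s ∩ T₀)) (s ∩ T₀) ∪ s \ T₀)
    have hk' : k ≤ #(Φ s ∩ T₀) := by
      rw [hsT, hΦ, compl_compl]
      have := hT₀sd (σ (#(s ∩ T₀)) (s ∩ T₀) ∪ s \ T₀); rw [h1] at this; omega
    rw [hΦ, compl_compl]
    refine ⟨h1, h2, by rw [h1]; omega, hsubR, hlev, (hmemW' _).2 ⟨by rwa [hΦ] at hk', Or.inr ?_⟩, by omega⟩
    rw [compl_compl]; omega
  -- regime B: huge members, matched levels (image small)
  have hB : ∀ s : Finset (Fin n), s ∈ W.filter (fun s => #s < l ∨ #sᶜ < l) → ¬ #s < l → #(sᶜ \ T₀) + t ≤ r + #(sᶜ ∩ T₀) →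
      Φ s ∩ T₀ = τ (#(sᶜ ∩ T₀)) (sᶜ ∩ T₀) ∧ Φ s \ T₀ = sᶜ \ T₀ ∧ #(Φ s ∩ T₀) + #(sᶜ ∩ T₀) = t ∧
      sᶜ ∩ T₀ ⊆ τ (#(sᶜ ∩ T₀)) (sᶜ ∩ T₀) ∧ 2 * #(sᶜ ∩ T₀) ≤ t ∧ Φ s ∈ W.filter (fun s => #s < l ∨ #sᶜ < l) ∧ #(Φ s) < l := by
    intro s hs hsl hmat
    obtain ⟨hk, hO⟩ := (hmemW' s).1 hs
    have hcl : #sᶜ < l := hO.resolve_left hsl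
    have hkt' : k + #(sᶜ ∩ T₀) ≤ t ∧ 2 * #(sᶜ ∩ T₀) ≤ t := by have h1 := hT₀sd sᶜ; rw [hsT s] at hk; omega
    obtain ⟨hkt', h2⟩ := hkt'
    obtain ⟨hmem, hsubR⟩ := (hτ (#(sᶜ ∩ T₀)) h2).2 (sᶜ ∩ T₀) (hpc sᶜ)
    rw [mem_powersetCard] at hmem
    have hΦ : Φ s = τ (#(sᶜ ∩ T₀)) (sᶜ ∩ T₀) ∪ (sᶜ \ T₀) := by simp only [Φ, Ψ, if_neg hsl, if_pos hmat]
    obtain ⟨h1, h2', h3⟩ := hparts _ _ hmem.1 (hsdZ sᶜ)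
    have hsz := hcardu sᶜ
    rw [hΦ]
    refine ⟨h1, h2', by rw [h1]; omega, hsubR, h2, (hmemW' _).2 ⟨by rw [h1]; omega, Or.inl ?_⟩, by omega⟩
    omega
  -- regime C: huge members, remaining levels (image huge)
  have hC : ∀ s : Finset (Fin n), s ∈ W.filter (fun s => #s < l ∨ #sᶜ < l) → ¬ #s < l → ¬ (#(sᶜ \ T₀) + t ≤ r + #(sᶜ ∩ T₀)) →
      (Φ s)ᶜ ∩ T₀ = kn T₀ (#(sᶜ ∩ T₀)) (sᶜ ∩ T₀) ∧ (Φ s)ᶜ \ T₀ = lam sᶜ ∧ #((Φ s)ᶜ ∩ T₀) = #(sᶜ ∩ T₀) ∧ Disjoint sᶜ (Φ s)ᶜ ∧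
      ((#(sᶜ ∩ T₀) + #Z ≤ r + #(sᶜ \ T₀) ∧ lam sᶜ = Z \ sᶜ ∧ #(lam sᶜ) + #(sᶜ \ T₀) = #Z) ∨
        (¬ (#(sᶜ ∩ T₀) + #Z ≤ r + #(sᶜ \ T₀)) ∧ lam sᶜ = kn Z (#(sᶜ \ T₀)) (sᶜ \ T₀) ∧ #(lam sᶜ) = #(sᶜ \ T₀) ∧
          2 * #(sᶜ \ T₀) ≤ #Z)) ∧ Φ s ∈ W.filter (fun s => #s < l ∨ #sᶜ < l) ∧ ¬ #(Φ s) < l := by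
    intro s hs hsl hmat
    obtain ⟨hk, hO⟩ := (hmemW' s).1 hs
    have hcl : #sᶜ < l := hO.resolve_left hsl
    have hkt' : k + #(sᶜ ∩ T₀) ≤ t ∧ 2 * #(sᶜ ∩ T₀) ≤ t := by have h1 := hT₀sd sᶜ; rw [hsT s] at hk; omega
    obtain ⟨hkt', h2⟩ := hkt'
    obtain ⟨hmem, hdisj⟩ := (hkn T₀ (#(sᶜ ∩ T₀)) h2).2 (sᶜ ∩ T₀) (hpc sᶜ)
    rw [mem_powersetCard] at hmem
    have hu := hcardu sᶜ
    have hΦ : Φ s = (kn T₀ (#(sᶜ ∩ T₀)) (sᶜ ∩ T₀) ∪ lam sᶜ)ᶜ := by simp only [Φ, Ψ, if_neg hsl, if_neg hmat]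
    -- the `Z`-part `lam sᶜ`: inside `Z`, disjoint from `sᶜ`, of controlled size
    have hY : lam sᶜ ⊆ Z ∧ Disjoint sᶜ (lam sᶜ) ∧ #(sᶜ ∩ T₀) + #(lam sᶜ) < l ∧
        ((#(sᶜ ∩ T₀) + #Z ≤ r + #(sᶜ \ T₀) ∧ lam sᶜ = Z \ sᶜ ∧ #(lam sᶜ) + #(sᶜ \ T₀) = #Z) ∨
          (¬ (#(sᶜ ∩ T₀) + #Z ≤ r + #(sᶜ \ T₀)) ∧ lam sᶜ = kn Z (#(sᶜ \ T₀)) (sᶜ \ T₀) ∧ #(lam sᶜ) = #(sᶜ \ T₀) ∧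
            2 * #(sᶜ \ T₀) ≤ #Z)) := by
      by_cases hcr : #(sᶜ ∩ T₀) + #Z ≤ r + #(sᶜ \ T₀)
      · have hlam : lam sᶜ = Z \ sᶜ := by simp only [lam, if_pos hcr]
        have hZ := hZsd sᶜ; rw [hlam]
        exact ⟨sdiff_subset, disjoint_sdiff, by omega, Or.inl ⟨hcr, rfl, hZ⟩⟩
      · have hlam : lam sᶜ = kn Z (#(sᶜ \ T₀)) (sᶜ \ T₀) := by simp only [lam, if_neg hcr]
        have h2b : 2 * #(sᶜ \ T₀) ≤ #Z := by omega
        obtain ⟨hmemκ, hdisjκ⟩ := (hkn Z (#(sᶜ \ T₀)) h2b).2 (sᶜ \ T₀) (hpcZ sᶜ)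
        rw [mem_powersetCard] at hmemκ; rw [hlam]
        refine ⟨hmemκ.1, disjoint_left.2 fun x hx hxκ => ?_, by rw [hmemκ.2]; omega, Or.inr ⟨hcr, rfl, hmemκ.2, h2b⟩⟩
        have hxZ : x ∈ Z := hmemκ.1 hxκ; rw [hZdef, mem_compl] at hxZ
        exact disjoint_left.1 hdisjκ (mem_sdiff.2 ⟨hx, hxZ⟩) hxκ
    obtain ⟨hYZ, hYdisj, hYsmall, hYcases⟩ := hY
    obtain ⟨h1, h2', h3⟩ := hparts _ _ hmem.1 hYZ
    have hc := hcardc (kn T₀ (#(sᶜ ∩ T₀)) (sᶜ ∩ T₀) ∪ lam sᶜ)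
    have hdisjall : Disjoint sᶜ (kn T₀ (#(sᶜ ∩ T₀)) (sᶜ ∩ T₀) ∪ lam sᶜ) := by
      rw [disjoint_union_right]
      exact ⟨disjoint_left.2 fun x hx hxX => disjoint_left.1 hdisj (mem_inter.2 ⟨hx, hmem.1 hxX⟩) hxX, hYdisj⟩
    have hk' : k ≤ #(Φ s ∩ T₀) := by
      rw [hsT, hΦ, compl_compl]
      have := hT₀sd (kn T₀ (#(sᶜ ∩ T₀)) (sᶜ ∩ T₀) ∪ lam sᶜ); rw [h1] at this; omega
    have hW' : Φ s ∈ W.filter (fun s => #s < l ∨ #sᶜ < l) :=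
      (hmemW' _).2 ⟨hk', Or.inr (by rw [hΦ, compl_compl, h3, hmem.2]; exact hYsmall)⟩
    rw [hΦ, compl_compl]
    exact ⟨h1, h2', by rw [h1, hmem.2], hdisjall, hYcases, by rwa [hΦ] at hW', by omega⟩
  -- conclude with the covering-map criterion of gen 21: `Φ` maps `W'` into itself, covers, and is injective
  refine AntiBandMatching.antiBand_of_covering_map l W V hV Φ (fun s hs => ?_) (fun s hs => ?_) ?_
  · by_cases hsl : #s < l
    · exact (hA s hs hsl).2.2.2.2.2.1
    · by_cases hmat : #(sᶜ \ T₀) + t ≤ r + #(sᶜ ∩ T₀)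
      · exact (hB s hs hsl hmat).2.2.2.2.2.1
      · exact (hC s hs hsl hmat).2.2.2.2.2.1
  · by_cases hsl : #s < l
    · obtain ⟨h1, h2, -, hXR, -⟩ := hA s hs hsl
      have : (Φ s)ᶜ ⊆ s := by
        rw [← hrec (Φ s)ᶜ, h1, h2]
        exact union_subset (hXR.trans inter_subset_left) sdiff_subset
      have := compl_subset_compl.2 this; rwa [compl_compl] at this
    · by_cases hmat : #(sᶜ \ T₀) + t ≤ r + #(sᶜ ∩ T₀)
      · obtain ⟨h1, h2, -, hRX, -⟩ := hB s hs hsl hmat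
        rw [← hrec (Φ s), h1, h2]
        exact (hrec sᶜ).symm.subset.trans (union_subset_union hRX le_rfl)
      · obtain ⟨-, -, -, hdisj, -⟩ := hC s hs hsl hmat
        exact fun x hx => by_contra fun hx' => disjoint_left.1 hdisj hx (mem_compl.2 hx')
  · intro s₁ hs₁ s₂ hs₂ h
    have hs₁' : s₁ ∈ W.filter (fun s => #s < l ∨ #sᶜ < l) := hs₁
    have hs₂' : s₂ ∈ W.filter (fun s => #s < l ∨ #sᶜ < l) := hs₂
    have hu₁ := hcardu s₁ᶜ; have hu₂ := hcardu s₂ᶜ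
    -- regime A versus regime C is excluded by cardinalities (either order)
    have hAC : ∀ s s' : Finset (Fin n), s ∈ W.filter (fun s => #s < l ∨ #sᶜ < l) → s' ∈ W.filter (fun s => #s < l ∨ #sᶜ < l) →
        #s < l → ¬ #s' < l → ¬ (#(s'ᶜ \ T₀) + t ≤ r + #(s'ᶜ ∩ T₀)) → Φ s ≠ Φ s' := by
      intro s s' hs hs' hsl hsl' hmat' heq
      obtain ⟨h1, h2, h3, -, hlev, -⟩ := hA s hs hsl
      obtain ⟨h1', h2', h3', -, hcases, -⟩ := hC s' hs' hsl' hmat'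
      have hcl' : #s'ᶜ < l := ((hmemW' s').1 hs').2.resolve_left hsl'
      have hX : #((Φ s)ᶜ ∩ T₀) = #((Φ s')ᶜ ∩ T₀) := by rw [heq]
      have hYeq : #(s \ T₀) = #(lam s'ᶜ) := by rw [← h2, ← h2', heq]
      have hw := hcardu s; have hw' := hcardu s'ᶜ
      rcases hcases with ⟨hcr, -, hZ⟩ | ⟨hcr, -, hb, -⟩ <;> omega
    by_cases hsl₁ : #s₁ < l <;> by_cases hsl₂ : #s₂ < l
    · -- A / A
      obtain ⟨h1₁, h2₁, h3₁, -, hlev₁, -⟩ := hA s₁ hs₁' hsl₁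
      obtain ⟨h1₂, h2₂, h3₂, -, hlev₂, -⟩ := hA s₂ hs₂' hsl₂
      have hX : σ (#(s₁ ∩ T₀)) (s₁ ∩ T₀) = σ (#(s₂ ∩ T₀)) (s₂ ∩ T₀) := by rw [← h1₁, ← h1₂, h]
      have hY : s₁ \ T₀ = s₂ \ T₀ := by rw [← h2₁, ← h2₂, h]
      have e : #((Φ s₁)ᶜ ∩ T₀) = #((Φ s₂)ᶜ ∩ T₀) := by rw [h]
      have ha : #(s₁ ∩ T₀) = #(s₂ ∩ T₀) := by omega
      rw [ha] at hX
      have hR : s₁ ∩ T₀ = s₂ ∩ T₀ := (hσ (#(s₂ ∩ T₀)) hlev₂).1 (by rw [← ha]; exact hpc s₁) (hpc s₂) hX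
      rw [← hrec s₁, ← hrec s₂, hR, hY]
    · by_cases hmat₂ : #(s₂ᶜ \ T₀) + t ≤ r + #(s₂ᶜ ∩ T₀)
      · exact absurd ((hB s₂ hs₂' hsl₂ hmat₂).2.2.2.2.2.2) (by rw [← h]; exact (hA s₁ hs₁' hsl₁).2.2.2.2.2.2)
      · exact absurd h (hAC s₁ s₂ hs₁' hs₂' hsl₁ hsl₂ hmat₂)
    · by_cases hmat₁ : #(s₁ᶜ \ T₀) + t ≤ r + #(s₁ᶜ ∩ T₀)
      · exact absurd ((hB s₁ hs₁' hsl₁ hmat₁).2.2.2.2.2.2) (by rw [h]; exact (hA s₂ hs₂' hsl₂).2.2.2.2.2.2)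
      · exact absurd h.symm (hAC s₂ s₁ hs₂' hs₁' hsl₂ hsl₁ hmat₁)
    · by_cases hmat₁ : #(s₁ᶜ \ T₀) + t ≤ r + #(s₁ᶜ ∩ T₀) <;> by_cases hmat₂ : #(s₂ᶜ \ T₀) + t ≤ r + #(s₂ᶜ ∩ T₀)
      · -- B / B
        obtain ⟨h1₁, h2₁, h3₁, -, hl₁, -⟩ := hB s₁ hs₁' hsl₁ hmat₁
        obtain ⟨h1₂, h2₂, h3₂, -, hl₂, -⟩ := hB s₂ hs₂' hsl₂ hmat₂
        have hX : τ (#(s₁ᶜ ∩ T₀)) (s₁ᶜ ∩ T₀) = τ (#(s₂ᶜ ∩ T₀)) (s₂ᶜ ∩ T₀) := by rw [← h1₁, ← h1₂, h]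
        have hY : s₁ᶜ \ T₀ = s₂ᶜ \ T₀ := by rw [← h2₁, ← h2₂, h]
        have e : #(Φ s₁ ∩ T₀) = #(Φ s₂ ∩ T₀) := by rw [h]
        have ha : #(s₁ᶜ ∩ T₀) = #(s₂ᶜ ∩ T₀) := by omega
        rw [ha] at hX
        have hR : s₁ᶜ ∩ T₀ = s₂ᶜ ∩ T₀ := (hτ (#(s₂ᶜ ∩ T₀)) hl₂).1 (by rw [← ha]; exact hpc s₁ᶜ) (hpc s₂ᶜ) hX
        exact compl_injective (by rw [← hrec s₁ᶜ, ← hrec s₂ᶜ, hR, hY])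
      · exact absurd ((hB s₁ hs₁' hsl₁ hmat₁).2.2.2.2.2.2) (by rw [h]; exact (hC s₂ hs₂' hsl₂ hmat₂).2.2.2.2.2.2)
      · exact absurd ((hB s₂ hs₂' hsl₂ hmat₂).2.2.2.2.2.2) (by rw [← h]; exact (hC s₁ hs₁' hsl₁ hmat₁).2.2.2.2.2.2)
      · -- C / C
        obtain ⟨h1₁, h2₁, h3₁, -, hcases₁, -⟩ := hC s₁ hs₁' hsl₁ hmat₁
        obtain ⟨h1₂, h2₂, h3₂, -, hcases₂, -⟩ := hC s₂ hs₂' hsl₂ hmat₂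
        have hcl₁ : #s₁ᶜ < l := ((hmemW' s₁).1 hs₁').2.resolve_left hsl₁
        have hcl₂ : #s₂ᶜ < l := ((hmemW' s₂).1 hs₂').2.resolve_left hsl₂
        have hX : kn T₀ (#(s₁ᶜ ∩ T₀)) (s₁ᶜ ∩ T₀) = kn T₀ (#(s₂ᶜ ∩ T₀)) (s₂ᶜ ∩ T₀) := by rw [← h1₁, ← h1₂, h]
        have hY : lam s₁ᶜ = lam s₂ᶜ := by rw [← h2₁, ← h2₂, h]
        have e : #((Φ s₁)ᶜ ∩ T₀) = #((Φ s₂)ᶜ ∩ T₀) := by rw [h]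
        have ha : #(s₁ᶜ ∩ T₀) = #(s₂ᶜ ∩ T₀) := by omega
        have h2a : 2 * #(s₂ᶜ ∩ T₀) ≤ t := by
          obtain ⟨hk₂, -⟩ := (hmemW' s₂).1 hs₂'; have := hT₀sd s₂ᶜ; rw [hsT s₂] at hk₂; omega
        rw [ha] at hX
        have hR : s₁ᶜ ∩ T₀ = s₂ᶜ ∩ T₀ := (hkn T₀ (#(s₂ᶜ ∩ T₀)) h2a).1 (by rw [← ha]; exact hpc s₁ᶜ) (hpc s₂ᶜ) hX
        have hYc : #(lam s₁ᶜ) = #(lam s₂ᶜ) := by rw [hY]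
        have hS : s₁ᶜ \ T₀ = s₂ᶜ \ T₀ := by
          rcases hcases₁ with ⟨hcr₁, hl₁, hZ₁⟩ | ⟨hcr₁, hl₁, hb₁, h2b₁⟩ <;>
            rcases hcases₂ with ⟨hcr₂, hl₂, hZ₂⟩ | ⟨hcr₂, hl₂, hb₂, h2b₂⟩
          · rw [hZint s₁ᶜ, hZint s₂ᶜ, ← hl₁, ← hl₂, hY]
          · exfalso; omega
          · exfalso; omega
          · have hb : #(s₁ᶜ \ T₀) = #(s₂ᶜ \ T₀) := by omega
            rw [hl₁, hl₂, hb] at hY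
            exact (hkn Z (#(s₂ᶜ \ T₀)) h2b₂).1 (by rw [← hb]; exact hpcZ s₁ᶜ) (hpcZ s₂ᶜ) hY
        exact compl_injective (by rw [← hrec s₁ᶜ, ← hrec s₂ᶜ, hR, hS])

/-- **(AB_l)(n) for a threshold junta on the right.**  For `1 ≤ l`, `2l ≤ n`, any up-set `A`, any `T₀` and `k` with `#T₀ < 2k`:
`#{s ∈ A ∩ Thᶜˢ | #s < l ∨ #sᶜ < l} ≤ #{s ∈ A ∩ Th | #s < l ∨ #sᶜ < l}`, `Th = {s | k ≤ #(s ∩ T₀)}` (symmetry `s ↦ sᶜ` + the left version).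
[this work] -/
theorem antiBand_threshold_right {n : ℕ} (l : ℕ) (hl : 1 ≤ l) (h2l : 2 * l ≤ n) (A : Finset (Finset (Fin n)))
    (hA : IsUpperSet (A : Set (Finset (Fin n)))) (T₀ : Finset (Fin n)) (k : ℕ) (hkt : #T₀ < 2 * k) :
    #((A ∩ (univ.filter fun s : Finset (Fin n) => k ≤ #(s ∩ T₀))ᶜˢ).filter fun s => #s < l ∨ #sᶜ < l)
      ≤ #((A ∩ (univ.filter fun s : Finset (Fin n) => k ≤ #(s ∩ T₀))).filter fun s => #s < l ∨ #sᶜ < l) := by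
  classical
  have hsymm : ∀ B : Finset (Finset (Fin n)),
      #((A ∩ Bᶜˢ).filter fun s => #s < l ∨ #sᶜ < l) = #((B ∩ Aᶜˢ).filter fun s => #s < l ∨ #sᶜ < l) := by
    intro B
    refine card_bij (fun s _ => sᶜ) (fun s hs => ?_) (fun s _ t _ h => compl_injective h) (fun t ht => ⟨tᶜ, ?_, compl_compl t⟩)
    · rw [mem_filter, mem_inter, mem_compls] at hs ⊢
      rw [compl_compl]; exact ⟨⟨hs.1.2, hs.1.1⟩, hs.2.symm⟩
    · rw [mem_filter, mem_inter, mem_compls] at ht ⊢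
      rw [compl_compl]; exact ⟨⟨ht.1.2, ht.1.1⟩, ht.2.symm⟩
  rw [hsymm, inter_comm A]
  exact antiBand_threshold_left l hl h2l T₀ k hkt A hA

end Summit.CriticalPhenomena.PercolationContinuityZ3.Theorems.AntiBandThreshold
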